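import Summits.QuantumFields.BalabanUV.Beta.GAN24.DerivativeRateTransferJensenMassFreeExpMeanEnd
import Summits.QuantumFields.BalabanUV.Beta.GAN24.DerivativeRateTransferJensenMassFreeRectangle

/-!
# `BalabanUV.Beta.GAN24.DerivativeRateTransferJensenMassFreeExpMeanLattice` — binder row G-an2-4 ∕ (CONV-C), route R6 «VALUES, NOT DERIVATIVES», PART 74:
# THE (1.28) PAIR's (STAB-ε,δ) ON THE BLOCK LATTICE FROM THE PLAQUETTE LETTER — PART 63's lattice instance for the SECOND convention: from a lattice
# gauge field `R` (orthogonal transporters, plaquettes within `p̂`), the COMB block transporters `W` and PART 24's straight chains, with `2d(L−1)Lp̂ < 1`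
# and `√(dim o)·2d(L−1)Lp̂ ≤ 1∕8`: for ANY prescribed roots `x₀(y,μ′)` in the block (print's (1.28): the central contour) THERE ARE polar links `R′(y,μ′)` and skew logarithms of the open transports such that
# (i) the polar pair satisfies PART 63's `δ = 0` inequality and (ii) the exp-mean-log links `R″(y,μ′) = exp(Σ_{block} L^{−d} log(τ·τ₀ᵀ))·τ₀` satisfy
#   `⟨Qu, H″_cQu⟩ ≤ (1+s)(1 + ε(2D,ϖ,ϖ′;t,r))·⟨u, H_fu⟩ + (1+s⁻¹)·(20D_F³ + 784D_F⁴)²·w_c·d·⟨Qu, Qu⟩`,  `D = 2d(L−1)Lp̂`, `D_F = √(dim o)·D`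
# — the in-degree of the coarse bond graph is `d` (unit b2b-balaban-gan24-p3, gen 45; v1)

NOT IN PRINT; OUR PROOF (for the ROUTE; PART 72 `exists_polar_expMean_covJensen_local` + PART 60 `loopDefect_lattice` + PART 24's combinatorics BY NAME — PART 63's
`refine` pattern verbatim).  HONEST FRAMING (cell contract, verbatim): «discharging `BetaPertH` makes Bałaban's UV stability UNCONDITIONAL — a real
constructive-QFT result; it is NOT the continuum limit and NOT the Clay problem.»  HONEST DEPENDENCY (verbatim): «continuum YM on T⁴ ⇐ BetaPertH ∧ nine spine
estimates (0/9 proved); BetaPertH ⇐ (D1) ∧ (D4) ∧ CAP+tail; G-an2-4 gates asym, D1 and NE2/3/4.»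

WHAT THIS FILE PROVES (0 sorry, 0 `def`, nothing cited): `indegree_coarseBond_le` (each coarse site is the target of at most `d` coarse bonds `(y, μ′) ↦ y + e_{μ′}`),
**`covJensen_expMean_lattice_of_plaquettes`** (the statement above; Poincaré data `Φ ∕ ϖ ∕ ϖ′` as hypotheses, as in PART 63 — PART 64's comb Poincaré datum
discharges them verbatim, ON REQUEST).
HONEST SCOPE: as PART 63 (one axis order; `p̂` a letter; `R′` ∕ logarithms in the full orthogonal group; the base `τ₀(y,μ′)` is the open transport through SOME
block site — print's (1.28) uses the central contour; Frobenius costs `√(dim o)`; crude constants); NOT the tower, NOT (CONS), NOT (CONV-C).  SUPPLIER work on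
route R6 (rank 2, REDUCTION, no seat); no consumer of record; NEVER «G-an2-4 closed»; NOT (CONV-C), NOT D1, NOT `BetaPertH`, NOT continuum, NOT Clay.
Records: `HOME/b2b-balaban-gan24-p3/WOODBURY-FIBRE.md` v14.5. -/

noncomputable section

open scoped Matrix Matrix.Norms.Frobenius
open NormedSpace Matrix Finset Function

namespace Summit.QuantumFields.BalabanUV.Beta.GAN24.DerivativeRateTransferJensenMassFreeExpMeanLattice

open Summit.QuantumFields.BalabanUV.Beta.GAN24.DerivativeRateTransferJensenLattice
open Summit.QuantumFields.BalabanUV.Beta.GAN24.DerivativeRateTransferJensenMassFreeRectangle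
open Summit.QuantumFields.BalabanUV.Beta.GAN24.DerivativeRateTransferJensenMassFreeExpMeanEnd

section End

variable {d L M : ℕ} {o : Type*} [Fintype o] [DecidableEq o]

omit [Fintype o] [DecidableEq o] in
/-- the coarse bond graph `(y, μ′) ↦ y + e_{μ′}` has in-degree at most `d`. [folklore] -/
theorem indegree_coarseBond_le [NeZero M] (y : Fin d → ZMod M) :
    ((Finset.univ.filter fun e' : (Fin d → ZMod M) × Fin d => e'.1 + Pi.single e'.2 1 = y).card : ℝ) ≤ d := by
  classical
  have hsub : (Finset.univ.filter fun e' : (Fin d → ZMod M) × Fin d => e'.1 + Pi.single e'.2 1 = y) ⊆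
      Finset.univ.image (fun μ : Fin d => ((y - Pi.single μ 1, μ) : (Fin d → ZMod M) × Fin d)) := by
    intro e' he'
    rw [Finset.mem_filter] at he'
    rw [Finset.mem_image]
    refine ⟨e'.2, Finset.mem_univ _, ?_⟩
    have h : e'.1 = y - Pi.single e'.2 1 := eq_sub_of_add_eq he'.2
    rw [← h]
  have h1 := Finset.card_le_card hsub
  have h2 : (Finset.univ.image (fun μ : Fin d => ((y - Pi.single μ 1, μ) : (Fin d → ZMod M) × Fin d))).card ≤ d :=
    Finset.card_image_le.trans (by simp)
  exact_mod_cast h1.trans h2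
set_option maxHeartbeats 400000 in
/-- **`covJensen_expMean_lattice_of_plaquettes` — THE (1.28) PAIR's (STAB-ε,δ) ON THE BLOCK LATTICE FROM THE PLAQUETTE LETTER** [our proof].  PART 63's data
(`R` orthogonal with plaquettes within `p̂`, comb `W`, averaging `Q`, fine form `H_f ≥ w_f·Σ|D_eu|²`, PART 24's chains `T`, `2d(L−1)Lp̂ < 1`) PLUS
`√(dim o)·2d(L−1)Lp̂ ≤ 1∕8` ⟹ for any roots `x₀(e′)` in the blocks ∃ orthogonal polar links `R′`, skew logarithms `A` on the blocks such that for every `w_c ≥ 0` with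
`w_c·L·(L·(L^d)⁻¹) ≤ w_f`, every `u` with block Poincaré data and all `s, t, r > 0`: (i) `⟨Qu,H_cQu⟩ ≤ (1 + ε)·⟨u,H_fu⟩` for every
`H_c ≤ w_cΣ|R′v(y+e_{μ′}) − v(y)|²`; (ii) `⟨Qu,H″_cQu⟩ ≤ (1+s)(1 + ε)·⟨u,H_fu⟩ + (1+s⁻¹)(20D_F³ + 784D_F⁴)²·w_c·d·⟨Qu,Qu⟩` for every
`H″_c ≤ w_cΣ|R″v(y+e_{μ′}) − v(y)|²`, `R″(y,μ′) = exp(Σ_{block} L^{−d}•A)·τ₀(y,μ′)`, `D = 2d(L−1)Lp̂`, `D_F = √(dim o)·D`. -/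
theorem covJensen_expMean_lattice_of_plaquettes [NeZero M] (hL : 0 < L)
    {R : ((Fin d → ZMod M) × (Fin d → Fin L)) × Fin d → Matrix o o ℝ} (hR : ∀ e, (R e)ᵀ * R e = 1) {phat : ℝ} (hphat : 0 ≤ phat)
    (hplaq : ∀ (p : (Fin d → ZMod M) × (Fin d → Fin L)) (μ' μ : Fin d), μ' ≠ μ → ∀ w : o → ℝ,
      ((R (p, μ') *
              R (((p.1 + (((p.2 μ' : ℕ) + 1) / L) • (Pi.single μ' (1 : ZMod M)), update p.2 μ' ⟨((p.2 μ' : ℕ) + 1) % L, Nat.mod_lt _ hL⟩) :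
                (Fin d → ZMod M) × (Fin d → Fin L)), μ) *
            (R (((p.1 + (((p.2 μ : ℕ) + 1) / L) • (Pi.single μ (1 : ZMod M)), update p.2 μ ⟨((p.2 μ : ℕ) + 1) % L, Nat.mod_lt _ hL⟩) :
                (Fin d → ZMod M) × (Fin d → Fin L)), μ'))ᵀ *
          (R (p, μ))ᵀ - 1) *ᵥ w) ⬝ᵥ
        ((R (p, μ') *
              R (((p.1 + (((p.2 μ' : ℕ) + 1) / L) • (Pi.single μ' (1 : ZMod M)), update p.2 μ' ⟨((p.2 μ' : ℕ) + 1) % L, Nat.mod_lt _ hL⟩) :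
                (Fin d → ZMod M) × (Fin d → Fin L)), μ) *
            (R (((p.1 + (((p.2 μ : ℕ) + 1) / L) • (Pi.single μ (1 : ZMod M)), update p.2 μ ⟨((p.2 μ : ℕ) + 1) % L, Nat.mod_lt _ hL⟩) :
                (Fin d → ZMod M) × (Fin d → Fin L)), μ'))ᵀ *
          (R (p, μ))ᵀ - 1) *ᵥ w) ≤ phat ^ 2 * (w ⬝ᵥ w))
    {W : (Fin d → ZMod M) → (Fin d → ZMod M) × (Fin d → Fin L) → Matrix o o ℝ} (hW : ∀ y x, (W y x)ᵀ * W y x = 1)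
    (hWstep : ∀ (y : Fin d → ZMod M) (z : Fin d → Fin L) (μ : Fin d) (h : (z μ : ℕ) + 1 < L), (∀ ν, μ < ν → (z ν : ℕ) = 0) →
      W y (y, update z μ ⟨(z μ : ℕ) + 1, h⟩) = W y (y, z) * R ((y, z), μ))
    {Q : Matrix ((Fin d → ZMod M) × o) (((Fin d → ZMod M) × (Fin d → Fin L)) × o) ℝ}
    (hQ : ∀ (u : ((Fin d → ZMod M) × (Fin d → Fin L)) × o → ℝ) (y : Fin d → ZMod M),
      (fun a => (Q *ᵥ u) (y, a)) = ∑ x, (if x.1 = y then ((L : ℝ) ^ d)⁻¹ else 0) • (W y x *ᵥ fun b => u (x, b)))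
    {Hf : Matrix (((Fin d → ZMod M) × (Fin d → Fin L)) × o) (((Fin d → ZMod M) × (Fin d → Fin L)) × o) ℝ} {wf : ℝ}
    (hHf : ∀ u : ((Fin d → ZMod M) × (Fin d → Fin L)) × o → ℝ,
      wf * ∑ e : ((Fin d → ZMod M) × (Fin d → Fin L)) × Fin d,
        ((R e *ᵥ fun b => u ((e.1.1 + ((((e.1.2 e.2 : ℕ) + 1) / L) • (Pi.single e.2 (1 : ZMod M))),
            update e.1.2 e.2 ⟨((e.1.2 e.2 : ℕ) + 1) % L, Nat.mod_lt _ hL⟩), b)) - fun b => u (e.1, b)) ⬝ᵥ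
          ((R e *ᵥ fun b => u ((e.1.1 + ((((e.1.2 e.2 : ℕ) + 1) / L) • (Pi.single e.2 (1 : ZMod M))),
            update e.1.2 e.2 ⟨((e.1.2 e.2 : ℕ) + 1) % L, Nat.mod_lt _ hL⟩), b)) - fun b => u (e.1, b)) ≤ u ⬝ᵥ (Hf *ᵥ u))
    {T : (Fin d → ZMod M) × Fin d → (Fin d → ZMod M) × (Fin d → Fin L) → ℕ → Matrix o o ℝ} (hT0 : ∀ e' x, T e' x 0 = 1)
    (hT : ∀ e' x i, i < L → T e' x (i + 1) = T e' x i *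
      R (((x.1 + (((x.2 e'.2 : ℕ) + i) / L) • (Pi.single e'.2 (1 : ZMod M)),
            update x.2 e'.2 ⟨((x.2 e'.2 : ℕ) + i) % L, Nat.mod_lt _ hL⟩) : (Fin d → ZMod M) × (Fin d → Fin L)), e'.2))
    (hsmall : 2 * (d * ((L : ℝ) - 1)) * (L * phat) < 1)
    (hsmall8 : Real.sqrt (Fintype.card o) * (2 * (d * ((L : ℝ) - 1)) * (L * phat)) ≤ 1 / 8)
    {x₀ : (Fin d → ZMod M) × Fin d → (Fin d → ZMod M) × (Fin d → Fin L)} (hx₀ : ∀ e', (x₀ e').1 = e'.1) :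
    ∃ (R' : (Fin d → ZMod M) × Fin d → Matrix o o ℝ)
      (A : ∀ e' : (Fin d → ZMod M) × Fin d,
        {x : (Fin d → ZMod M) × (Fin d → Fin L) // (if x.1 = e'.1 then ((L : ℝ) ^ d)⁻¹ else 0) ≠ 0} → Matrix o o ℝ),
      (∀ e', (R' e')ᵀ * R' e' = 1) ∧ (∀ e' x, (A e' x)ᵀ = -A e' x) ∧
      (∀ e' x, exp (A e' x) * (W e'.1 (x₀ e') * T e' (x₀ e') L *
          (W (e'.1 + Pi.single e'.2 1) (((Equiv.addRight (Pi.single e'.2 (1 : ZMod M))).prodCongr (Equiv.refl (Fin d → Fin L))) (x₀ e')))ᵀ) =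
        W e'.1 x * T e' x L * (W (e'.1 + Pi.single e'.2 1) (((Equiv.addRight (Pi.single e'.2 (1 : ZMod M))).prodCongr (Equiv.refl (Fin d → Fin L))) x))ᵀ) ∧
      (∀ e' x, ‖A e' x‖ ≤ 2 * (Real.sqrt (Fintype.card o) * (2 * (d * ((L : ℝ) - 1)) * (L * phat)))) ∧
      ∀ (wc : ℝ) (_hwc : 0 ≤ wc) (_hw : wc * L * (L * ((L : ℝ) ^ d)⁻¹) ≤ wf) (u : ((Fin d → ZMod M) × (Fin d → Fin L)) × o → ℝ)
        (Φ : (((Fin d → ZMod M) × (Fin d → Fin L)) × o → ℝ) → (Fin d → ZMod M) → ℝ) (ϖ ϖ' : ℝ)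
        (_hP : ∀ y, ∑ x, (if x.1 = y then ((L : ℝ) ^ d)⁻¹ else 0) * (((W y x *ᵥ fun b => u (x, b)) - fun a => (Q *ᵥ u) (y, a)) ⬝ᵥ
          ((W y x *ᵥ fun b => u (x, b)) - fun a => (Q *ᵥ u) (y, a))) ≤ Φ u y)
        (_hΦ : wc * ∑ e' : (Fin d → ZMod M) × Fin d, Φ u (e'.1 + Pi.single e'.2 1) ≤ ϖ * (u ⬝ᵥ (Hf *ᵥ u)))
        (_hΦ' : wc * ∑ e' : (Fin d → ZMod M) × Fin d, Φ u e'.1 ≤ ϖ' * (u ⬝ᵥ (Hf *ᵥ u)))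
        (s t r : ℝ) (_hs : 0 < s) (_ht : 0 < t) (_hr : 0 < r),
        (∀ Hc : Matrix ((Fin d → ZMod M) × o) ((Fin d → ZMod M) × o) ℝ,
          (∀ v : (Fin d → ZMod M) × o → ℝ, v ⬝ᵥ (Hc *ᵥ v) ≤
            wc * ∑ e' : (Fin d → ZMod M) × Fin d, ((R' e' *ᵥ fun a => v (e'.1 + Pi.single e'.2 1, a)) - fun a => v (e'.1, a)) ⬝ᵥ
              ((R' e' *ᵥ fun a => v (e'.1 + Pi.single e'.2 1, a)) - fun a => v (e'.1, a))) →
          (Q *ᵥ u) ⬝ᵥ (Hc *ᵥ (Q *ᵥ u)) ≤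
            (1 + t + (1 + t⁻¹) * (1 + r) * ϖ * (2 * (2 * (d * ((L : ℝ) - 1)) * (L * phat))) ^ 2 +
                (1 + t⁻¹) * (1 + r⁻¹) * (3 * (2 * (2 * (d * ((L : ℝ) - 1)) * (L * phat))) ^ 2 /
                  (4 - (2 * (2 * (d * ((L : ℝ) - 1)) * (L * phat))) ^ 2)) * (1 + ϖ + ϖ')) * (u ⬝ᵥ (Hf *ᵥ u))) ∧
        (∀ Hc'' : Matrix ((Fin d → ZMod M) × o) ((Fin d → ZMod M) × o) ℝ,
          (∀ v : (Fin d → ZMod M) × o → ℝ, v ⬝ᵥ (Hc'' *ᵥ v) ≤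
            wc * ∑ e' : (Fin d → ZMod M) × Fin d,
              (((exp (∑ x : {x : (Fin d → ZMod M) × (Fin d → Fin L) // (if x.1 = e'.1 then ((L : ℝ) ^ d)⁻¹ else 0) ≠ 0},
                    (if (x : (Fin d → ZMod M) × (Fin d → Fin L)).1 = e'.1 then ((L : ℝ) ^ d)⁻¹ else 0) • A e' x) *
                  (W e'.1 (x₀ e') * T e' (x₀ e') L *
                    (W (e'.1 + Pi.single e'.2 1) (((Equiv.addRight (Pi.single e'.2 (1 : ZMod M))).prodCongr (Equiv.refl (Fin d → Fin L))) (x₀ e')))ᵀ)) *ᵥ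
                  fun a => v (e'.1 + Pi.single e'.2 1, a)) - fun a => v (e'.1, a)) ⬝ᵥ
              (((exp (∑ x : {x : (Fin d → ZMod M) × (Fin d → Fin L) // (if x.1 = e'.1 then ((L : ℝ) ^ d)⁻¹ else 0) ≠ 0},
                    (if (x : (Fin d → ZMod M) × (Fin d → Fin L)).1 = e'.1 then ((L : ℝ) ^ d)⁻¹ else 0) • A e' x) *
                  (W e'.1 (x₀ e') * T e' (x₀ e') L *
                    (W (e'.1 + Pi.single e'.2 1) (((Equiv.addRight (Pi.single e'.2 (1 : ZMod M))).prodCongr (Equiv.refl (Fin d → Fin L))) (x₀ e')))ᵀ)) *ᵥ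
                  fun a => v (e'.1 + Pi.single e'.2 1, a)) - fun a => v (e'.1, a))) →
          (Q *ᵥ u) ⬝ᵥ (Hc'' *ᵥ (Q *ᵥ u)) ≤
            (1 + s) * ((1 + t + (1 + t⁻¹) * (1 + r) * ϖ * (2 * (2 * (d * ((L : ℝ) - 1)) * (L * phat))) ^ 2 +
                (1 + t⁻¹) * (1 + r⁻¹) * (3 * (2 * (2 * (d * ((L : ℝ) - 1)) * (L * phat))) ^ 2 /
                  (4 - (2 * (2 * (d * ((L : ℝ) - 1)) * (L * phat))) ^ 2)) * (1 + ϖ + ϖ')) * (u ⬝ᵥ (Hf *ᵥ u))) +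
              (1 + s⁻¹) * (20 * (Real.sqrt (Fintype.card o) * (2 * (d * ((L : ℝ) - 1)) * (L * phat))) ^ 3 +
                  784 * (Real.sqrt (Fintype.card o) * (2 * (d * ((L : ℝ) - 1)) * (L * phat))) ^ 4) ^ 2 * wc * d *
                ((Q *ᵥ u) ⬝ᵥ (Q *ᵥ u))) := by
  haveI : NeZero L := ⟨hL.ne'⟩
  have hD0 : 0 ≤ 2 * (d * ((L : ℝ) - 1)) * (L * phat) := by
    have hL1 : (1 : ℝ) ≤ L := by exact_mod_cast hL
    have : 0 ≤ (L : ℝ) - 1 := by linarith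
    positivity
  -- positive weight means `x.1 = y`
  have hblock : ∀ (y : Fin d → ZMod M) (x : (Fin d → ZMod M) × (Fin d → Fin L)),
      (if x.1 = y then ((L : ℝ) ^ d)⁻¹ else 0) ≠ 0 → x.1 = y := fun y x hx => by
    by_contra h
    exact hx (if_neg h)
  -- the local loop letter in PART 62's letters
  have hloc : ∀ (e' : (Fin d → ZMod M) × Fin d) (x x' : (Fin d → ZMod M) × (Fin d → Fin L)),
      (if x.1 = e'.1 then ((L : ℝ) ^ d)⁻¹ else 0) ≠ 0 → (if x'.1 = e'.1 then ((L : ℝ) ^ d)⁻¹ else 0) ≠ 0 → ∀ w : o → ℝ,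
      (((W e'.1 x * T e' x L *
              (W (e'.1 + Pi.single e'.2 1) (((Equiv.addRight (Pi.single e'.2 (1 : ZMod M))).prodCongr (Equiv.refl (Fin d → Fin L))) x))ᵀ)ᵀ *
            (W e'.1 x' * T e' x' L *
              (W (e'.1 + Pi.single e'.2 1) (((Equiv.addRight (Pi.single e'.2 (1 : ZMod M))).prodCongr (Equiv.refl (Fin d → Fin L))) x'))ᵀ) -
            1) *ᵥ w) ⬝ᵥ
        (((W e'.1 x * T e' x L *
              (W (e'.1 + Pi.single e'.2 1) (((Equiv.addRight (Pi.single e'.2 (1 : ZMod M))).prodCongr (Equiv.refl (Fin d → Fin L))) x))ᵀ)ᵀ *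
            (W e'.1 x' * T e' x' L *
              (W (e'.1 + Pi.single e'.2 1) (((Equiv.addRight (Pi.single e'.2 (1 : ZMod M))).prodCongr (Equiv.refl (Fin d → Fin L))) x'))ᵀ) -
            1) *ᵥ w) ≤ (2 * (d * ((L : ℝ) - 1)) * (L * phat)) ^ 2 * (w ⬝ᵥ w) := by
    intro e' x x' hx hx' w
    obtain ⟨x1, x2⟩ := x
    obtain ⟨x1', x2'⟩ := x'
    have h1 : x1 = e'.1 := hblock e'.1 (x1, x2) hx
    have h1' : x1' = e'.1 := hblock e'.1 (x1', x2') hx'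
    subst h1 h1'
    exact loopDefect_lattice hL hR hphat hplaq hW hWstep hT0 hT e' x2 x2' w
  refine exists_polar_expMean_covJensen_local (o := o) (μ := Fin d → ZMod M) (ν := (Fin d → ZMod M) × (Fin d → Fin L))
    (β := ((Fin d → ZMod M) × (Fin d → Fin L)) × Fin d) (β' := (Fin d → ZMod M) × Fin d)
    (q := fun (y : Fin d → ZMod M) (x : (Fin d → ZMod M) × (Fin d → Fin L)) => if x.1 = y then ((L : ℝ) ^ d)⁻¹ else 0)
    (W := W) (Q := Q) (src := fun e : ((Fin d → ZMod M) × (Fin d → Fin L)) × Fin d => e.1)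
    (tgt := fun e : ((Fin d → ZMod M) × (Fin d → Fin L)) × Fin d =>
      ((e.1.1 + ((((e.1.2 e.2 : ℕ) + 1) / L) • (Pi.single e.2 (1 : ZMod M))),
        update e.1.2 e.2 ⟨((e.1.2 e.2 : ℕ) + 1) % L, Nat.mod_lt _ hL⟩) : (Fin d → ZMod M) × (Fin d → Fin L)))
    (R := R) (src' := fun e' : (Fin d → ZMod M) × Fin d => e'.1)
    (tgt' := fun e' : (Fin d → ZMod M) × Fin d => e'.1 + Pi.single e'.2 1) (Hf := Hf) (wf := wf)
    (σ := fun e' : (Fin d → ZMod M) × Fin d => (Equiv.addRight (Pi.single e'.2 (1 : ZMod M))).prodCongr (Equiv.refl (Fin d → Fin L)))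
    (ℓ := L)
    (xs := fun (e' : (Fin d → ZMod M) × Fin d) (x : (Fin d → ZMod M) × (Fin d → Fin L)) (i : ℕ) =>
      ((x.1 + (((x.2 e'.2 : ℕ) + i) / L) • (Pi.single e'.2 (1 : ZMod M)),
        update x.2 e'.2 ⟨((x.2 e'.2 : ℕ) + i) % L, Nat.mod_lt _ hL⟩) : (Fin d → ZMod M) × (Fin d → Fin L)))
    (γ := fun (e' : (Fin d → ZMod M) × Fin d) (x : (Fin d → ZMod M) × (Fin d → Fin L)) (i : ℕ) =>
      (((x.1 + (((x.2 e'.2 : ℕ) + i) / L) • (Pi.single e'.2 (1 : ZMod M)),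
        update x.2 e'.2 ⟨((x.2 e'.2 : ℕ) + i) % L, Nat.mod_lt _ hL⟩) : (Fin d → ZMod M) × (Fin d → Fin L)), e'.2))
    (T := T) (m := L * ((L : ℝ) ^ d)⁻¹) (D := 2 * (d * ((L : ℝ) - 1)) * (L * phat)) (d' := d)
    ?_ ?_ hW hR hQ ?hf ?_ ?_ ?_ ?_ ?_ hT0 hT ?_ ?_ hD0 hsmall hsmall8 ?_ ?_
  case hf =>
    intro u'
    convert hHf u' using 6
  · exact fun y x => blockWeight_nonneg y x
  · exact fun y => sum_blockWeight y
  · exact fun e' x => blockWeight_pair e'.1 (Pi.single e'.2 1) x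
  · exact fun e' x => chain_zero hL e'.2 x
  · intro e' x
    show _ = ((Equiv.addRight (Pi.single e'.2 (1 : ZMod M))).prodCongr (Equiv.refl (Fin d → Fin L))) x
    rw [chain_end hL e'.2 x]
    rfl
  · exact fun e' x i _ => rfl
  · exact fun e' x i _ => chain_step hL e'.2 x i
  · exact fun e => (sum_chainWeight hL e).le
  · exact hloc
  · exact fun y => indegree_coarseBond_le y
  · intro e'
    rw [if_pos (hx₀ e')]
    exact inv_ne_zero (pow_ne_zero _ (Nat.cast_ne_zero.mpr (NeZero.ne L)))

end End

end Summit.QuantumFields.BalabanUV.Beta.GAN24.DerivativeRateTransferJensenMassFreeExpMeanLattice
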